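import Summits.QuantumFields.BalabanUV.Beta.D1BFx.FrozenLegProfile
import Literature.MathematicalPhysics.QuantumFieldTheory.Balaban1983to89.Beta.VectorTailsPt

/-!
# `BalabanUV.Beta.D1BFx.FrozenLegTails` — road «BF-x» for binder row D1: THE FAR ROWS d0∕d1 OF THE FROZEN PROFILE `gfrz` ARE THEOREMS MODULO
# [B5, Prop. 1.2 (1.110)–(1.114)] AND [B5, (1.126)–(1.127)] BY NAME (the (α)-leaf in its printed currency)

HONEST DEPENDENCY (page 1, mandatory): continuum YM on T⁴ ⇐ BetaPertH ∧ nine spine estimates (0/9 proved); BetaPertH ⇐ (D1) ∧ (D4) ∧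
CAP+tail; G-an2-4 gates asym, D1 and NE2/3/4.  HONEST FRAMING (cell contract, verbatim): «discharging `BetaPertH` makes Bałaban's UV
stability UNCONDITIONAL — a real constructive-QFT result; it is NOT the continuum limit and NOT the Clay problem.»  THIS MODULE DISCHARGES
NOTHING of the wall by itself: it turns two displayed hypotheses of road BF-x's END (`RoadEndBFxRecut.d1Drift_BFx_recut` p224363, the far rows
`d0`∕`d1` of `gfrz`) into consequences of TWO PRINTED STATEMENTS OF B5 taken BY NAME as hypotheses — `B5.Prop12Printed` [cite-free here; the
`[cite:]` tags live on the Literature `def`s: Balaban1984PropagatorsI Prop. 1.2 (1.110)–(1.114) pp. 35–36] and `B5.Kernel126_127Printed`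
[(1.126)–(1.127) p. 38] — for the reading `VectorTailsLoc.fam`∕`kfam` of the torus propagators `𝒢 = Δ_a⁻¹`.  Nothing printed is proved here and
no `Prop` is minted: the two named facts enter ONLY as the hypotheses `h12`, `h126` (exactly as in an5's `VectorTailsPt`), so every theorem below
is CONDITIONAL on them (the gate records `conditional-result`).  [folklore] bookkeeping otherwise: an5's `VectorTailsPt.legs_pt_A` (the rows on
every torus, uniformly in the volume, inside the faithful box), `VectorPropagatorLimit.calG_re_tendsto_Kinf` (the entrywise limit `n²G_T → K^∞`
along the even cubic volumes), `Kinf_symm`, the sign-pattern calculus of `FrozenLegProfile` and its convexity transfers, and the tree's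
UNCONDITIONAL window row h1 (`DiagonalLegGrade.abs_Kinf_diag_flat_sub_right_le`) for the one degenerate step.  0 sorry; 0 wall binders
(hW∕hR∕D1Tel∕D1Rep = 0∕4); NOT D1, NOT `BetaPertH`, NOT continuum, NOT Clay.

ABSOLUTE RULE (cell charter, verbatim): «No internally-minted statement may enter as a cited fact. Every hypothesis is either kernel-proved in
this package or a verbatim quotation of a PUBLISHED theorem with page reference. The manuscript(s) under audit are NOT citable for their own
disputed steps — they are the thing under adjudication; programme-internal (2001/route/tribunal) claims are never citable.»

WHY (owner d1-p2, LEAVES-BFx OPEN LEAF TABLE v1.9 «far rows h2∕d0∕d1∕d2 of `gfrz` (B5 Prop. 1.2)»; this lineage's `FrozenLegProfile` header: «the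
d-rows need the scale-`n` tails of `K^∞` — B5 Prop. 1.2 content, the (α)-leaf, NOT in the tree»).  The vector-road lineage (an4∕an5) HAS typed that
content in the printed currency: `VectorTailsPt.legs_pt_A` derives, from `B5.Prop12Printed (fam …)` and `B5.Kernel126_127Printed (kfam …)`, the value
row and the one-difference rows of `n²·Re 𝒢_T((x₀+v,κ),(x₀,ν₀))` with ONE rate `δ` and constants fixed before the instance, and
`VectorPropagatorLimit` passes every entry to the limit `K^∞`.  This file composes the two for the DIAGONAL entries and transports the result through
the 64 sign patterns of R-10′ to `gfrz`:
* §1 `Kinf_rows_of_prop12` — `|K^∞((b,κ),(b+w,κ))| ≤ A₀e^{−(δ/n)‖w‖∞}/‖w‖∞²` and `|K^∞((b,κ),(b+w+e_ρ,κ)) − K^∞((b,κ),(b+w,κ))| ≤ A₁e^{−(δ/n)‖w‖∞}/‖w‖∞³`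
  (`w ≠ 0`, every `n ≥ 1`, `b`, `κ`, `ρ`), modulo `h12`∕`h126`;
* §2 `gfrz_rows_d0_d1_of_prop12` — the END's rows d0 and d1 for `gfrz n a b` ON ALL OF `ℤ⁴ ∖ {0}`, EVERY `n ≥ 1`, EVERY base point (a step `+e_ρ` of
  `v` is a step `±e_ρ` of the far point `b + ε•v`; the backward step is a forward step read from `ε•(v+e_ρ)` and transported by an5's
  `exp_transport`∕`inv_pow_transport`; the degenerate step `ε•(v+e_ρ) = 0` is `abs_Kinf_diag_self_sub_step_le`, constant `cornerConst a`);
* §3 `far_rows_d0_d1_of_prop12` — the same in the LITERAL binder shape of `d1Drift_BFx_recut`∕`…_recut_shell` (`∀ n ≥ 2, ∀ [NeZero n], ∀ b ∈ image resSite`).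
WHAT IS NOT DONE HERE: h2∕d2 (same-leg second differences — not in Prop. 1.2's printed pointwise list; see `RoadEndBFxRecutShell` for the shell currency),
and the discharge of `h12`∕`h126` themselves (printed, quoted, unproved: the (α)-leaf).
Unit `b2b-balaban-beta-d1-formalise-leaf-03` (gen 5), D1 formalisation swarm; `LEAVES-BFx.md` sub-row «FAR-d0d1@Prop12».
-/

noncomputable section

namespace Summit.QuantumFields.BalabanUV.Beta.D1BFx.FrozenLegTails

open Filter Topology
open Literature.MathematicalPhysics.QuantumFieldTheory.Balaban1983to89
open Literature.MathematicalPhysics.QuantumFieldTheory.Balaban1983to89.Beta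
open B5Prop11Plancherel (calG fine Tor)
open DyadicShell (Pt supNorm)
open BubbleTransfer (unitVec)
open VectorTails (castT castT_add)
open VectorTailsPt (rd rdM InBox legs_pt_A eventually_inBox abs_re_le)
open VectorTailsLoc (fam kfam)
open VectorPropagatorLimit (Kinf calG_re_tendsto_Kinf Kinf_symm)
open BlockKernelVolumeSockets (evenPeriod)
open FreeLegDictionary (cubic)

/-- [our object] THE INSTANCE FAMILY OF THE ROAD'S (α)-LEAF: scale `n = i.1 ≥ 1` and the even cubic volume with `2(i.2+1)` blocks per side
(the volumes along which `VectorPropagatorLimit.calG_re_tendsto_Kinf` passes to `K^∞`). -/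
abbrev nOf (i : ℕ+ × ℕ) : ℕ := (i.1 : ℕ)

/-- [our object] the volumes of the family (`cubic 4 (2(t+1))`). -/
abbrev MOf (i : ℕ+ × ℕ) : Fin 4 → ℕ := cubic 4 (evenPeriod i.2)

/-- [folklore] every scale of the family is `≥ 1`. -/
theorem hn1 (i : ℕ+ × ℕ) : 1 ≤ nOf i := i.1.pos

variable (a : ℝ) (ha : 0 < a)

/-- [folklore] the sides `n · 2(t+1)` of the family's tori tend to infinity with the volume index. -/
theorem sides_tendsto (n : ℕ+) (μ : Fin 4) : Tendsto (fun t : ℕ => nOf (n, t) * MOf (n, t) μ) atTop atTop := by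
  refine tendsto_atTop_mono (fun t => ?_) tendsto_id
  show t ≤ (n : ℕ) * (2 * (t + 1))
  have h1 : 1 ≤ (n : ℕ) := n.pos
  nlinarith

/-- [folklore] **THE VALUE AND FAR-DIFFERENCE TAILS OF `K^∞`, MODULO [B5, Prop. 1.2 (1.110)–(1.114)] AND [B5, (1.126)–(1.127)] BY NAME.**
If the printed Proposition 1.2 holds for the reading `VectorTailsLoc.fam` of the covariant torus propagators `𝒢 = Δ_a⁻¹` of the family (every scale
`n ≥ 1`, even cubic volumes) and the printed kernel bounds (1.126)–(1.127) hold for `VectorTailsLoc.kfam`, then there are `δ > 0`, `A₀, A₁ ≥ 0` — chosen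
before the scale, the base point, the component and the displacement — with, for every `n ≥ 1`, `b, w ∈ ℤ⁴`, `w ≠ 0`, `κ`:
`|K^∞((b,κ),(b+w,κ))| ≤ A₀e^{−(δ/n)‖w‖∞}/‖w‖∞²` and `|K^∞((b,κ),(b+w+e_ρ,κ)) − K^∞((b,κ),(b+w,κ))| ≤ A₁e^{−(δ/n)‖w‖∞}/‖w‖∞³` (every `ρ`).
Proof: an5's `VectorTailsPt.legs_pt_A` (torus rows, uniformly in the volume, inside the faithful box) + `eventually_inBox` + the entrywise limit
`VectorPropagatorLimit.calG_re_tendsto_Kinf` + `Kinf_symm`. -/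
theorem Kinf_rows_of_prop12 (h12 : B5.Prop12Printed (fam nOf hn1 MOf a ha)) (h126 : B5.Kernel126_127Printed (kfam nOf MOf)) :
    ∃ δ A₀ A₁ : ℝ, 0 < δ ∧ 0 ≤ A₀ ∧ 0 ≤ A₁ ∧
      ∀ (n : ℕ) [NeZero n] (b w : Pt) (κ : Fin 4), w ≠ 0 →
        |Kinf n a (b, κ) (b + w, κ)| ≤ A₀ * Real.exp (-(δ / n) * supNorm w) / (supNorm w : ℝ) ^ 2 ∧
        ∀ ρ : Fin 4, |Kinf n a (b, κ) (b + w + unitVec ρ, κ) - Kinf n a (b, κ) (b + w, κ)| ≤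
          A₁ * Real.exp (-(δ / n) * supNorm w) / (supNorm w : ℝ) ^ 3 := by
  obtain ⟨δ, A, hδ, hA, h⟩ := legs_pt_A nOf hn1 MOf a ha h12 h126
  refine ⟨δ, A 0, A 1, hδ, hA 0, hA 1, fun n _ b w κ hw => ?_⟩
  have hn : 1 ≤ n := Nat.one_le_iff_ne_zero.mpr (NeZero.ne n)
  -- the torus readings at volume index `t`: every fixed `w` is eventually in the faithful box
  have hbox : ∀ᶠ t : ℕ in atTop, InBox (fine n (cubic 4 (evenPeriod t))) w :=
    eventually_inBox nOf MOf (l := atTop) (fun t : ℕ => ((⟨n, hn⟩ : ℕ+), t)) (sides_tendsto ⟨n, hn⟩) w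
  have key : ∀ t : ℕ, InBox (fine n (cubic 4 (evenPeriod t))) w →
      |rd n hn (cubic 4 (evenPeriod t)) a ha (castT _ b) κ κ Complex.reAddGroupHom w| ≤
          A 0 * Real.exp (-(δ / n) * supNorm w) / (supNorm w : ℝ) ^ 2 ∧
      ∀ ρ : Fin 4, |rd n hn (cubic 4 (evenPeriod t)) a ha (castT _ b) κ κ Complex.reAddGroupHom (w + unitVec ρ) -
          rd n hn (cubic 4 (evenPeriod t)) a ha (castT _ b) κ κ Complex.reAddGroupHom w| ≤
          A 1 * Real.exp (-(δ / n) * supNorm w) / (supNorm w : ℝ) ^ 3 := by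
    intro t ht
    have h' := h ((⟨n, hn⟩ : ℕ+), t) (castT _ b) κ κ Complex.reAddGroupHom abs_re_le w hw ht
    exact ⟨h'.1, h'.2.1⟩
  -- the readings ARE the sequences of `calG_re_tendsto_Kinf`
  have erd : ∀ (t : ℕ) (v : Pt), rd n hn (cubic 4 (evenPeriod t)) a ha (castT _ b) κ κ Complex.reAddGroupHom v =
      ((n : ℕ) : ℝ) ^ 2 * (calG n hn (cubic 4 (evenPeriod t)) a ha (castT (fine n (cubic 4 (evenPeriod t))) (b + v), κ)
        (castT (fine n (cubic 4 (evenPeriod t))) b, κ)).re := by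
    intro t v
    simp only [rd, rdM, VectorLegVolumeAdapter.re_apply, castT_add]
  have lim0 : Tendsto (fun t => rd n hn (cubic 4 (evenPeriod t)) a ha (castT _ b) κ κ Complex.reAddGroupHom w) atTop
      (𝓝 (Kinf n a (b + w, κ) (b, κ))) := by
    simp only [erd]
    exact calG_re_tendsto_Kinf n hn a ha (by norm_num) (b + w) b κ κ
  have lim1 : ∀ ρ : Fin 4, Tendsto (fun t => rd n hn (cubic 4 (evenPeriod t)) a ha (castT _ b) κ κ Complex.reAddGroupHom (w + unitVec ρ) -
      rd n hn (cubic 4 (evenPeriod t)) a ha (castT _ b) κ κ Complex.reAddGroupHom w) atTop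
      (𝓝 (Kinf n a (b + w + unitVec ρ, κ) (b, κ) - Kinf n a (b + w, κ) (b, κ))) := by
    intro ρ
    simp only [erd]
    rw [show Kinf n a (b + w + unitVec ρ, κ) (b, κ) = Kinf n a (b + (w + unitVec ρ), κ) (b, κ) by rw [add_assoc]]
    exact (calG_re_tendsto_Kinf n hn a ha (by norm_num) (b + (w + unitVec ρ)) b κ κ).sub
      (calG_re_tendsto_Kinf n hn a ha (by norm_num) (b + w) b κ κ)
  have hsymm : ∀ x : Pt, Kinf n a (x, κ) (b, κ) = Kinf n a (b, κ) (x, κ) := fun x =>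
    Kinf_symm n hn a ha (by norm_num) (x, κ) (b, κ)
  refine ⟨?_, fun ρ => ?_⟩
  · rw [← hsymm]
    exact le_of_tendsto lim0.abs (hbox.mono fun t ht => (key t ht).1)
  · rw [← hsymm (b + w + unitVec ρ), ← hsymm (b + w)]
    exact le_of_tendsto (lim1 ρ).abs (hbox.mono fun t ht => (key t ht).2 ρ)


/-! ## §2 From the entries of `K^∞` to the road's frozen profile `gfrz`: rows d0 and d1, every sign pattern -/

section Profile

open FrozenLegProfile (sgnVec sgnVec_apply gProf gfrz abs_gfrz_d0_of_gProf abs_gfrz_d1_of_gProf sgnVec_add sgnVec_unitVec_of_false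
  sgnVec_unitVec_of_true)
open PoissonInterior (G₀)
open LongitudinalWindow (ellD1)
open WoodburyCovariant (woodburyD1c)
open VectorTailsPt (exp_transport inv_pow_transport)
open Summit.QuantumFields.BalabanUV.Beta.D1BFx.GluonLeg (Ga Ga_apply)
open Summit.QuantumFields.BalabanUV.Beta.D1BFx.DiagonalLegGrade (abs_Kinf_diag_flat_sub_right_le)

/-- [folklore] sign patterns preserve the sup norm. -/
theorem supNorm_sgnVec (ε : Fin 4 → Bool) (v : Pt) : supNorm (sgnVec ε v) = supNorm v := by
  unfold DyadicShell.supNorm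
  congr 1
  funext i
  by_cases h : ε i <;> simp [sgnVec_apply, h, Int.natAbs_neg]

/-- [folklore] sign patterns fix only `0`. -/
theorem sgnVec_ne_zero (ε : Fin 4 → Bool) {v : Pt} (hv : v ≠ 0) : sgnVec ε v ≠ 0 := by
  intro h
  apply hv
  funext i
  have hi := congrFun h i
  by_cases hε : ε i
  · simp only [sgnVec_apply, hε, if_true, Pi.zero_apply, neg_eq_zero] at hi; exact hi
  · simp only [sgnVec_apply, hε, Pi.zero_apply] at hi; simpa using hi

/-- [folklore] `sgnVec ε v = 0` forces `v = 0`. -/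
theorem eq_zero_of_sgnVec_eq_zero (ε : Fin 4 → Bool) {v : Pt} (h : sgnVec ε v = 0) : v = 0 := by
  by_contra hv; exact sgnVec_ne_zero ε hv h

/-- [our object] the constant of the DEGENERATE step `v = −ε•e_ρ` of row d1 (the far point returns to the base point): the h1 window constant of the tree
plus the free leg's nearest-neighbour drop `Σ_ρ |G₀(e_ρ) − G₀(0)|`. -/
def cornerConst (a : ℝ) : ℝ := (woodburyD1c 0 + ellD1 4 a) + ∑ ρ : Fin 4, |G₀ (Pi.single ρ 1 : Pt) - G₀ (0 : Pt)|

variable {a}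

/-- [folklore] **THE DEGENERATE STEP**: `|K^∞((b,κ),(b,κ)) − K^∞((b,κ),(b+e_ρ,κ))| ≤ cornerConst a` for `n ≥ 1`, `a > 0` (the tree's UNCONDITIONAL window row h1
`DiagonalLegGrade.abs_Kinf_diag_flat_sub_right_le` at `x = x′ = b`, plus the free leg's own drop). -/
theorem abs_Kinf_diag_self_sub_step_le (n : ℕ) [NeZero n] (ha : 0 < a) (b : Pt) (κ ρ : Fin 4) :
    |Kinf n a (b, κ) (b, κ) - Kinf n a (b, κ) (b + Pi.single ρ 1, κ)| ≤ cornerConst a := by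
  have hn : 1 ≤ n := Nat.one_le_iff_ne_zero.mpr (NeZero.ne n)
  have h1 := abs_Kinf_diag_flat_sub_right_le n hn ha κ ρ b b
  rw [add_sub_cancel_left, sub_self] at h1
  have hnpow : (1 : ℝ) ≤ (n : ℝ) ^ 3 := one_le_pow₀ (by exact_mod_cast hn)
  have hD : 0 ≤ woodburyD1c 0 + ellD1 4 a :=
    add_nonneg VectorLegVolumeAdapter.woodburyD1c_zero_nonneg (OffDiagonalLegGrade.ellD1_nonneg ha)
  have h1' : |(Kinf n a (b, κ) (b + Pi.single ρ 1, κ) - G₀ (Pi.single ρ 1 : Pt)) - (Kinf n a (b, κ) (b, κ) - G₀ (0 : Pt))| ≤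
      woodburyD1c 0 + ellD1 4 a :=
    h1.trans (div_le_self hD hnpow)
  have hfree : |G₀ (Pi.single ρ 1 : Pt) - G₀ (0 : Pt)| ≤ ∑ ρ' : Fin 4, |G₀ (Pi.single ρ' 1 : Pt) - G₀ (0 : Pt)| :=
    Finset.single_le_sum (f := fun ρ' : Fin 4 => |G₀ (Pi.single ρ' 1 : Pt) - G₀ (0 : Pt)|) (fun _ _ => abs_nonneg _) (Finset.mem_univ ρ)
  have e : Kinf n a (b, κ) (b, κ) - Kinf n a (b, κ) (b + Pi.single ρ 1, κ) =
      -((Kinf n a (b, κ) (b + Pi.single ρ 1, κ) - G₀ (Pi.single ρ 1 : Pt)) - (Kinf n a (b, κ) (b, κ) - G₀ (0 : Pt))) -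
        (G₀ (Pi.single ρ 1 : Pt) - G₀ (0 : Pt)) := by
    ring
  rw [e]
  refine (abs_sub _ _).trans ?_
  rw [abs_neg, cornerConst]
  exact add_le_add h1' hfree

/-- [folklore] `cornerConst a ≥ 0`. -/
theorem cornerConst_nonneg (ha : 0 < a) : 0 ≤ cornerConst a := by
  unfold cornerConst
  exact add_nonneg (add_nonneg VectorLegVolumeAdapter.woodburyD1c_zero_nonneg (OffDiagonalLegGrade.ellD1_nonneg ha))
    (Finset.sum_nonneg fun _ _ => abs_nonneg _)

/-- [folklore] **ROWS d0 AND d1 OF THE ROAD'S FROZEN PROFILE `gfrz`, MODULO [B5, Prop. 1.2] AND [B5, (1.126)–(1.127)] BY NAME** — on ALL of `ℤ⁴ ∖ {0}`, for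
every scale `n ≥ 1` and EVERY base point (hence in particular in the binder shape `∀ n ≥ 2, ∀ b ∈ image resSite` of `RoadEndBFxRecut.d1Drift_BFx_recut` ∕
`RoadEndBFxRecutShell.d1Drift_BFx_recut_shell`), with ONE rate `δ > 0` and constants `A₀, A₁ ≥ 0` fixed before everything:
`|gfrz n a b v| ≤ A₀e^{−(δ/n)‖v‖∞}/‖v‖∞²` and `|gfrz n a b (v+e_ρ) − gfrz n a b v| ≤ A₁e^{−(δ/n)‖v‖∞}/‖v‖∞³`.  Proof: §1 for every reflected profile
`gProf ε κ v = K^∞((b,κ),(b+ε•v,κ))` (`‖ε•v‖∞ = ‖v‖∞`; a step `+e_ρ` of `v` is a step `±e_ρ` of the far point — the backward step is a forward step read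
from `ε•(v+e_ρ)`, transported by `VectorTailsPt.exp_transport`∕`inv_pow_transport`, and the degenerate case `ε•(v+e_ρ) = 0` is
`abs_Kinf_diag_self_sub_step_le`), then convexity over the 64 profiles (`FrozenLegProfile.abs_gfrz_d0_of_gProf`∕`abs_gfrz_d1_of_gProf`). -/
theorem gfrz_rows_d0_d1_of_prop12 (ha : 0 < a) (h12 : B5.Prop12Printed (fam nOf hn1 MOf a ha)) (h126 : B5.Kernel126_127Printed (kfam nOf MOf)) :
    ∃ δ A₀ A₁ : ℝ, 0 < δ ∧ 0 ≤ A₀ ∧ 0 ≤ A₁ ∧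
      (∀ (n : ℕ) [NeZero n] (b v : Pt), v ≠ 0 → |gfrz n a b v| ≤ A₀ * Real.exp (-(δ / n) * supNorm v) / (supNorm v : ℝ) ^ 2) ∧
      (∀ (n : ℕ) [NeZero n] (b v : Pt), v ≠ 0 → ∀ ρ : Fin 4,
        |gfrz n a b (v + unitVec ρ) - gfrz n a b v| ≤ A₁ * Real.exp (-(δ / n) * supNorm v) / (supNorm v : ℝ) ^ 3) := by
  obtain ⟨δ, A₀, A₁, hδ, hA₀, hA₁, hK⟩ := Kinf_rows_of_prop12 a ha h12 h126
  have hcc := cornerConst_nonneg ha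
  refine ⟨δ, A₀, A₁ + 8 * Real.exp δ * A₁ + Real.exp δ * cornerConst a, hδ, hA₀, by positivity, ?_, ?_⟩
  · intro n _ b v hv
    refine abs_gfrz_d0_of_gProf n b v fun ε κ => ?_
    have h := (hK n b (sgnVec ε v) κ (sgnVec_ne_zero ε hv)).1
    rwa [supNorm_sgnVec] at h
  · intro n _ b v hv ρ
    have hn : 1 ≤ n := Nat.one_le_iff_ne_zero.mpr (NeZero.ne n)
    have hnR : (1 : ℝ) ≤ n := by exact_mod_cast hn
    have hS1 : (1 : ℝ) ≤ (supNorm v : ℝ) := by exact_mod_cast Nat.one_le_iff_ne_zero.mpr (mt DyadicShell.supNorm_eq_zero_iff.mp hv)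
    have hSpos : (0 : ℝ) < (supNorm v : ℝ) := lt_of_lt_of_le one_pos hS1
    set E : ℝ := Real.exp (-(δ / n) * supNorm v) with hE
    have hEpos : 0 < E := Real.exp_pos _
    -- the three case constants are each below the total
    have hle1 : A₁ * E / (supNorm v : ℝ) ^ 3 ≤ (A₁ + 8 * Real.exp δ * A₁ + Real.exp δ * cornerConst a) * E / (supNorm v : ℝ) ^ 3 := by
      gcongr; nlinarith [Real.exp_pos δ, hA₁, hcc]
    have hle2 : 8 * Real.exp δ * A₁ * E / (supNorm v : ℝ) ^ 3 ≤
        (A₁ + 8 * Real.exp δ * A₁ + Real.exp δ * cornerConst a) * E / (supNorm v : ℝ) ^ 3 := by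
      gcongr; nlinarith [Real.exp_pos δ, hA₁, hcc]
    have hle3 : Real.exp δ * cornerConst a * E / (supNorm v : ℝ) ^ 3 ≤
        (A₁ + 8 * Real.exp δ * A₁ + Real.exp δ * cornerConst a) * E / (supNorm v : ℝ) ^ 3 := by
      gcongr; nlinarith [Real.exp_pos δ, hA₁, hcc]
    refine abs_gfrz_d1_of_gProf n b v ρ fun ε κ => ?_
    -- the far points: `b + ε•(v+e_ρ) = b + ε•v ± e_ρ`
    simp only [gProf, Ga_apply]
    cases hρ : ε ρ
    · -- forward step of the far point: §1's d1 at `ε•v`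
      rw [sgnVec_add, sgnVec_unitVec_of_false hρ, ← add_assoc]
      have h := (hK n b (sgnVec ε v) κ (sgnVec_ne_zero ε hv)).2 ρ
      rw [supNorm_sgnVec] at h
      exact h.trans hle1
    · -- backward step: read it as a forward step from `w := ε•(v+e_ρ)`
      by_cases hw : sgnVec ε (v + unitVec ρ) = 0
      · -- degenerate: `v = −ε•e_ρ`, `‖v‖∞ = 1`, the far point returns to `b`
        have hv1 : v + unitVec ρ = 0 := eq_zero_of_sgnVec_eq_zero ε hw
        have hveq : v = -unitVec ρ := eq_neg_of_add_eq_zero_left hv1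
        have hsv : sgnVec ε v = Pi.single ρ 1 := by
          rw [hveq, show -unitVec ρ = sgnVec (fun _ => true) (unitVec ρ) from FrozenLegProfile.neg_eq_sgnVec _,
            FrozenLegProfile.sgnVec_sgnVec, sgnVec_unitVec_of_false]
          simp [hρ]
        have hS : (supNorm v : ℝ) = 1 := by
          rw [hveq, show -unitVec ρ = sgnVec (fun _ => true) (unitVec ρ) from FrozenLegProfile.neg_eq_sgnVec _, supNorm_sgnVec]
          exact_mod_cast TwoPowerLegs.supNorm_unitVec ρ
        rw [hw, hsv, add_zero]
        have hc := abs_Kinf_diag_self_sub_step_le n ha b κ ρ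
        rw [abs_sub_comm] at hc
        refine le_trans ?_ hle3
        rw [hS, one_pow, div_one]
        calc |Kinf n a (b, κ) (b, κ) - Kinf n a (b, κ) (b + Pi.single ρ 1, κ)|
            ≤ cornerConst a := by rw [abs_sub_comm]; exact hc
          _ = Real.exp δ * cornerConst a * Real.exp (-δ) := by rw [mul_comm (Real.exp δ), mul_assoc, ← Real.exp_add, add_neg_cancel, Real.exp_zero, mul_one]
          _ ≤ Real.exp δ * cornerConst a * E := by
              refine mul_le_mul_of_nonneg_left ?_ (by positivity)
              rw [hE, hS, mul_one]
              exact Real.exp_le_exp.mpr (by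
                have : δ / n ≤ δ := div_le_self hδ.le hnR
                linarith)
      · -- generic backward step
        have h := (hK n b (sgnVec ε (v + unitVec ρ)) κ hw).2 ρ
        have ew : sgnVec ε (v + unitVec ρ) + unitVec ρ = sgnVec ε v := by
          rw [sgnVec_add, sgnVec_unitVec_of_true hρ]; simp [unitVec]
        rw [add_assoc, ew] at h
        rw [abs_sub_comm]
        refine h.trans ?_
        -- transport the envelope from `‖v+e_ρ‖∞` to `‖v‖∞`
        rw [supNorm_sgnVec]
        have hT : (supNorm v : ℝ) ≤ (supNorm (v + unitVec ρ) : ℝ) + 1 := by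
          have h' := TwoPowerLegs.supNorm_sub_le_supNorm_add v (unitVec ρ)
          rw [TwoPowerLegs.supNorm_unitVec] at h'
          push_cast at h'
          linarith
        have hwpos : (0 : ℝ) < (supNorm (v + unitVec ρ) : ℝ) := by
          exact_mod_cast Nat.pos_of_ne_zero (mt DyadicShell.supNorm_eq_zero_iff.mp fun h0 => hw (by rw [h0]; funext i; simp [sgnVec_apply]))
        have hw1 : (1 : ℝ) ≤ (supNorm (v + unitVec ρ) : ℝ) := by exact_mod_cast (show 0 < supNorm (v + unitVec ρ) by exact_mod_cast hwpos)
        have hhalf : (supNorm v : ℝ) / 2 ≤ (supNorm (v + unitVec ρ) : ℝ) := by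
          rcases le_or_gt (supNorm v : ℝ) 2 with h2 | h2
          · linarith
          · linarith
        have hexp := exp_transport (δ := δ) (δ' := δ) hnR hδ.le le_rfl hSpos.le hT
        have hinv := inv_pow_transport hSpos hhalf 3
        calc A₁ * Real.exp (-(δ / n) * (supNorm (v + unitVec ρ) : ℝ)) / (supNorm (v + unitVec ρ) : ℝ) ^ 3
            = A₁ * Real.exp (-(δ / n) * (supNorm (v + unitVec ρ) : ℝ)) * (1 / (supNorm (v + unitVec ρ) : ℝ) ^ 3) := by ring
          _ ≤ A₁ * (Real.exp δ * E) * (2 ^ 3 / (supNorm v : ℝ) ^ 3) := by gcongr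
          _ = 8 * Real.exp δ * A₁ * E / (supNorm v : ℝ) ^ 3 := by ring
          _ ≤ _ := hle2

end Profile


/-! ## §3 The END's binders d0/d1, literally -/

section EndShape

open FrozenLegProfile (gfrz)
open DressedMomentNormalisation (resSite)

variable {a}

/-- [folklore] **THE FAR ROWS d0∕d1 OF `RoadEndBFxRecut.d1Drift_BFx_recut` ∕ `RoadEndBFxRecutShell.d1Drift_BFx_recut_shell`, IN THEIR LITERAL BINDER
SHAPE, MODULO [B5, Prop. 1.2] AND [B5, (1.126)–(1.127)] BY NAME**: one rate `δ > 0` and constants `A₀, A₁ ≥ 0` with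
`∀ n ≥ 2, ∀ b ∈ image resSite, ∀ v ≠ 0, |gfrz n a b v| ≤ A₀e^{−(δ/n)‖v‖∞}/‖v‖∞²` and the one-step row with `A₁`. -/
theorem far_rows_d0_d1_of_prop12 (ha : 0 < a) (h12 : B5.Prop12Printed (fam nOf hn1 MOf a ha))
    (h126 : B5.Kernel126_127Printed (kfam nOf MOf)) :
    ∃ δ A₀ A₁ : ℝ, 0 < δ ∧ 0 ≤ A₀ ∧ 0 ≤ A₁ ∧
      (∀ n : ℕ, 2 ≤ n → ∀ [NeZero n], ∀ b ∈ (Finset.univ : Finset (Fin 4 → Fin n)).image resSite, ∀ v : Pt, v ≠ 0 →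
        |gfrz n a b v| ≤ A₀ * Real.exp (-(δ / n) * supNorm v) / (supNorm v : ℝ) ^ 2) ∧
      (∀ n : ℕ, 2 ≤ n → ∀ [NeZero n], ∀ b ∈ (Finset.univ : Finset (Fin 4 → Fin n)).image resSite, ∀ v : Pt, v ≠ 0 → ∀ ρ : Fin 4,
        |gfrz n a b (v + unitVec ρ) - gfrz n a b v| ≤ A₁ * Real.exp (-(δ / n) * supNorm v) / (supNorm v : ℝ) ^ 3) := by
  obtain ⟨δ, A₀, A₁, hδ, hA₀, hA₁, h0, h1⟩ := gfrz_rows_d0_d1_of_prop12 ha h12 h126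
  exact ⟨δ, A₀, A₁, hδ, hA₀, hA₁, fun n _ _ b _ v hv => h0 n b v hv, fun n _ _ b _ v hv ρ => h1 n b v hv ρ⟩

end EndShape

end Summit.QuantumFields.BalabanUV.Beta.D1BFx.FrozenLegTails

end
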